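import Summits.AtomisticToContinuum.HydrodynamicLimit.Theses.RelayRaceLocality
import Literature.Analysis.FluidPDE.HardSpherePhaseSpaceProofs
import Literature.MathematicalPhysics.KineticTheory.HardSphereEulerProofs

/-!
# Degenerate regimes of `GibbsLightCone`: what is free, what is junk, what C⁺ cannot look like

Negative-lane small-model facts for the crux `RelayRaceLocality.GibbsLightCone`
(stmt-AtomisticToContinuum-12501), from the standing disprover's
`Cruxes/GibbsLightCone/Disproof.lean` §A2, §A3, §A5, §C. Theorems only (no new definitions); none
concludes a Theses declaration.

* `event_null_at_time_zero`: at `t = 0` the crux event is Gibbs-null for every `δ ≥ 0`, every `N`,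
  every flow and all parameters (`Φ_0 = id` on the conull good set, `BC(i,(0,0]) = ∅`).
* `event_eq_empty_of_le`: once `√3/2 ≤ c t + δ` the crux event is EMPTY (no minimal-image
  distance on the unit `3`-torus exceeds `√3/2`, `euclidDist_le_sqrt_three_half`). So the crux has
  content only for `0 < t < (√3/2 - δ)/c`.
* `localGibbsLaw_eq_zero_of_temp_nonpos`: for `θ ≤ 0` the homogeneous Gibbs law is the ZERO
  measure (the Maxwellian prefactor `(2πθ)^{-3/2}` is the `Real.rpow` junk `0`), hence the crux
  shape holds vacuously for every cone speed (`shape_of_temp_nonpos`): the hypothesis `0 < θ` of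
  the crux carries no mathematical load (mutation finding; the physics is in `0 < σ`).
* `taggedWindow_event_eq_empty`, `taggedWindow_lam_nonneg`: for the tagged one-window event of the
  line `Sketch` (`stub_taggedWindowSpanTail`, C⁺) — threshold `λ M ℓ`, window `M τ` — the event is
  empty once `λ M ℓ ≥ √3/2` (so C⁺ has content only for `M < √3/(2 λ ℓ_N) ≍ N^{1/3}`), and an
  exponential-in-`M` bound for all `M ≥ 1` under a probability law forces `0 ≤ λ` (for `λ < 0`
  the event is everything).

refuter-cdisprove-stmt-AtomisticToContinuum-12501-0.
-/

noncomputable section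

namespace Summit.AtomisticToContinuum.HydrodynamicLimit.Theorems.GibbsLightConeDegenerate

open MeasureTheory Filter Set
open scoped ENNReal Topology
open Literature.MathematicalPhysics.KineticTheory Literature.Analysis.FluidPDE

/-! ## `t = 0` is free -/

/-- The homogeneous Gibbs law does not charge the complement of the good set
(`particleLaw = liouville.withDensity _` and `liouville goodᶜ = 0`). [folklore] -/
theorem localGibbsLaw_compl_good (σ a θ : ℝ) (N : ℕ)
    (Φ : HardSphereFlow (Torus.geometry (Fin 3)) (hsDiameter σ N) (N + 1)) :
    localGibbsLaw σ (fun _ => a) (fun _ => 0) (fun _ => θ) N Φ Φ.goodᶜ = 0 := by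
  rw [localGibbsLaw, particleLaw_eq]
  exact withDensity_absolutelyContinuous _ _ Φ.measure_compl_good

/-- At `t = 0` the crux event lies in the complement of the good set, for every `δ ≥ 0`: on the
good set `Φ_0 z = z` and the backward cluster over the empty window `(0, 0]` is empty, so the
event asks `δ < dist(x_i, x_i) = 0`. [folklore] -/
theorem event_at_time_zero_subset {σ : ℝ} {N : ℕ}
    (Φ : HardSphereFlow (Torus.geometry (Fin 3)) (hsDiameter σ N) (N + 1)) (c : ℝ) {δ : ℝ}
    (hδ : 0 ≤ δ) :
    {z : Config (N + 1) (Fin 3) T3 | ∃ i j : Fin (N + 1),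
        (j = i ∨ j ∈ Φ.backwardCluster i 0 0 z) ∧
          c * 0 + δ < Torus.euclidDist (z j).1 (Φ.flow 0 z i).1} ⊆ Φ.goodᶜ := by
  rintro z ⟨i, j, hij, hlt⟩ hz
  have hfl : Φ.flow 0 z = z := Φ.flow_zero z hz
  rcases hij with rfl | hmem
  · rw [hfl, Torus.euclidDist_self, mul_zero, zero_add] at hlt
    exact absurd hlt (not_lt.2 hδ)
  · rw [HardSphereFlow.backwardCluster_apply Φ hz,
      Literature.MathematicalPhysics.KineticTheory.backwardCluster_of_le le_rfl] at hmem
    simp at hmem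

/-- **The `t = 0` slice of `GibbsLightCone` is Gibbs-null**, for every `δ ≥ 0` (so `δ = 0` is
harmless there), every `N`, every flow and all `σ, a, θ, c`. [folklore] -/
theorem event_null_at_time_zero (σ a θ : ℝ) (N : ℕ)
    (Φ : HardSphereFlow (Torus.geometry (Fin 3)) (hsDiameter σ N) (N + 1)) (c : ℝ) {δ : ℝ}
    (hδ : 0 ≤ δ) :
    localGibbsLaw σ (fun _ => a) (fun _ => 0) (fun _ => θ) N Φ
      {z | ∃ i j : Fin (N + 1), (j = i ∨ j ∈ Φ.backwardCluster i 0 0 z) ∧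
        c * 0 + δ < Torus.euclidDist (z j).1 (Φ.flow 0 z i).1} = 0 :=
  measure_mono_null (event_at_time_zero_subset Φ c hδ) (localGibbsLaw_compl_good σ a θ N Φ)

/-! ## Large times are free -/

/-- Minimal-image distances on the unit `3`-torus are at most `√3/2`
(`Torus.norm_reprSym_le_holds`). [folklore] -/
theorem euclidDist_le_sqrt_three_half (x y : T3) : Torus.euclidDist x y ≤ Real.sqrt 3 / 2 := by
  have h := Torus.norm_reprSym_le_holds (x - y)
  simpa [Torus.euclidDist, Fintype.card_fin] using h

/-- **The crux event is empty once `√3/2 ≤ c t + δ`**: `GibbsLightCone` has content only for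
`t < (√3/2 - δ)/c`. [folklore] -/
theorem event_eq_empty_of_le {σ : ℝ} {N : ℕ}
    (Φ : HardSphereFlow (Torus.geometry (Fin 3)) (hsDiameter σ N) (N + 1)) {c t δ : ℝ}
    (h : Real.sqrt 3 / 2 ≤ c * t + δ) :
    {z : Config (N + 1) (Fin 3) T3 | ∃ i j : Fin (N + 1),
        (j = i ∨ j ∈ Φ.backwardCluster i 0 t z) ∧
          c * t + δ < Torus.euclidDist (z j).1 (Φ.flow t z i).1} = ∅ := by
  ext z
  simp only [mem_setOf_eq, mem_empty_iff_false, iff_false, not_exists, not_and, not_lt]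
  intro i j _
  exact (euclidDist_le_sqrt_three_half _ _).trans h

/-! ## `0 < θ` is not load-bearing: for `θ ≤ 0` the law is the zero measure -/

/-- The `Real.rpow` junk: for `θ ≤ 0` the local Maxwellian on `ℝ³` vanishes identically
(`(2πθ)^{-3/2} = 0` for a negative base since `cos(-3π/2) = 0`, and `0^{-3/2} = 0`). [folklore] -/
theorem localMaxwellian_eq_zero_of_temp_nonpos {θ : ℝ} (hθ : θ ≤ 0) (ρ : ℝ) (u v : V3) :
    localMaxwellian ρ θ u v = 0 := by
  unfold localMaxwellian
  have hfin : (Module.finrank ℝ V3 : ℝ) = 3 := by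
    rw [finrank_euclideanSpace_fin]; norm_num
  have hexp : (-(Module.finrank ℝ V3 : ℝ) / 2 : ℝ) = -(3 / 2) := by rw [hfin]; norm_num
  rw [hexp]
  have hbase : (2 * Real.pi * θ) ^ (-(3 / 2 : ℝ)) = 0 := by
    rcases hθ.eq_or_lt with rfl | hlt
    · rw [mul_zero, Real.zero_rpow (by norm_num)]
    · have hneg : 2 * Real.pi * θ < 0 := mul_neg_of_pos_of_neg (by positivity) hlt
      rw [Real.rpow_def_of_neg hneg]
      have hcos : Real.cos (-(3 / 2 : ℝ) * Real.pi) = 0 := by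
        rw [show -(3 / 2 : ℝ) * Real.pi = -(Real.pi / 2 + Real.pi) by ring, Real.cos_neg,
          Real.cos_add_pi, Real.cos_pi_div_two, neg_zero]
      rw [hcos, mul_zero]
  rw [hbase, mul_zero, zero_mul]

/-- **For `θ ≤ 0` the homogeneous Gibbs law is the ZERO measure** (every `σ, a, N`, every flow):
the one-particle profile vanishes, hence so do the tensor power and the canonical density.
[folklore] -/
theorem localGibbsLaw_eq_zero_of_temp_nonpos {θ : ℝ} (hθ : θ ≤ 0) (σ a : ℝ) (N : ℕ)
    (Φ : HardSphereFlow (Torus.geometry (Fin 3)) (hsDiameter σ N) (N + 1)) :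
    localGibbsLaw σ (fun _ => a) (fun _ => 0) (fun _ => θ) N Φ = 0 := by
  have hprof : localGibbsProfile (fun _ => a) (fun _ => (0 : V3)) (fun _ => θ) = 0 := by
    funext y
    simp [localGibbsProfile, localMaxwellian_eq_zero_of_temp_nonpos hθ]
  have hdens : ∀ z, canonicalDensity (Torus.geometry (Fin 3)) (hsDiameter σ N) (N + 1)
      (localGibbsProfile (fun _ => a) (fun _ => (0 : V3)) (fun _ => θ)) z = 0 := by
    intro z
    rw [hprof, canonicalDensity]
    have htp : tensorPow (N + 1) (0 : T3 × V3 → ℝ) z = 0 := by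
      simp [tensorPow]
    by_cases hz : z ∈ hardSphereDomain (Torus.geometry (Fin 3)) (N + 1) (hsDiameter σ N)
    · rw [indicator_of_mem hz, htp, mul_zero]
    · rw [indicator_of_notMem hz, mul_zero]
  rw [localGibbsLaw, particleLaw_eq]
  have h0 : (fun z => ENNReal.ofReal (canonicalDensity (Torus.geometry (Fin 3)) (hsDiameter σ N)
      (N + 1) (localGibbsProfile (fun _ => a) (fun _ => (0 : V3)) (fun _ => θ)) z)) = 0 := by
    funext z
    rw [hdens z, ENNReal.ofReal_zero, Pi.zero_apply]
  rw [h0, withDensity_zero]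

/-- **The crux SHAPE holds vacuously for `θ ≤ 0`, with any cone speed** — the hypothesis `0 < θ`
of `GibbsLightCone` only excludes a junk-trivial case. [folklore] -/
theorem shape_of_temp_nonpos {θ : ℝ} (hθ : θ ≤ 0) (σ a c t δ : ℝ)
    (Φ : (N : ℕ) → HardSphereFlow (Torus.geometry (Fin 3)) (hsDiameter σ N) (N + 1)) :
    Tendsto (fun N => localGibbsLaw σ (fun _ => a) (fun _ => 0) (fun _ => θ) N (Φ N)
      {z | ∃ i j : Fin (N + 1), (j = i ∨ j ∈ (Φ N).backwardCluster i 0 t z) ∧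
        c * t + δ < Torus.euclidDist (z j).1 ((Φ N).flow t z i).1}) atTop (𝓝 0) := by
  have h0 : (fun N => localGibbsLaw σ (fun _ => a) (fun _ => 0) (fun _ => θ) N (Φ N)
      {z | ∃ i j : Fin (N + 1), (j = i ∨ j ∈ (Φ N).backwardCluster i 0 t z) ∧
        c * t + δ < Torus.euclidDist (z j).1 ((Φ N).flow t z i).1}) = fun _ => 0 :=
    funext fun N => by rw [localGibbsLaw_eq_zero_of_temp_nonpos hθ]; rfl
  rw [h0]
  exact tendsto_const_nhds

/-! ## The tagged one-window event of C⁺ (`stub_taggedWindowSpanTail`) -/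

/-- **C⁺ is empty for large windows**: once `√3/2 ≤ λ M ℓ` the tagged one-window event is empty
(so with `ℓ = ℓ_N = (N+1)^{-1/3}/σ²` its content is `M < √3 σ² (N+1)^{1/3}/(2λ)`). [folklore] -/
theorem taggedWindow_event_eq_empty {σ : ℝ} {N : ℕ}
    (Φ : HardSphereFlow (Torus.geometry (Fin 3)) (hsDiameter σ N) (N + 1)) (p : Fin (N + 1))
    {lam M ℓ τ : ℝ} (h : Real.sqrt 3 / 2 ≤ lam * M * ℓ) :
    {z : Config (N + 1) (Fin 3) T3 | ∃ r : Fin (N + 1),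
        (r = p ∨ r ∈ Φ.backwardCluster p 0 (M * τ) z) ∧
          lam * M * ℓ < Torus.euclidDist (z r).1 (Φ.flow (M * τ) z p).1} = ∅ := by
  ext z
  simp only [mem_setOf_eq, mem_empty_iff_false, iff_false, not_exists, not_and, not_lt]
  intro r _
  exact (euclidDist_le_sqrt_three_half _ _).trans h

/-- With a negative threshold the tagged one-window event is everything. [folklore] -/
theorem taggedWindow_event_eq_univ {σ : ℝ} {N : ℕ}
    (Φ : HardSphereFlow (Torus.geometry (Fin 3)) (hsDiameter σ N) (N + 1)) (p : Fin (N + 1))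
    {lam M ℓ τ : ℝ} (h : lam * M * ℓ < 0) :
    {z : Config (N + 1) (Fin 3) T3 | ∃ r : Fin (N + 1),
        (r = p ∨ r ∈ Φ.backwardCluster p 0 (M * τ) z) ∧
          lam * M * ℓ < Torus.euclidDist (z r).1 (Φ.flow (M * τ) z p).1} = univ :=
  eq_univ_of_forall fun _ => ⟨p, Or.inl rfl, h.trans_le (norm_nonneg _)⟩

/-- **No C⁺ witness has `λ < 0`**: an exponential-in-`M` bound on the tagged one-window event for
all `M ≥ 1` under the homogeneous Gibbs law (`a, θ > 0`, `σ ≤ 1/2`, so a probability measure) and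
`ℓ > 0` forces `0 ≤ λ`, because for `λ < 0` the event is everything and `C e^{-cM} → 0`. (The
`lam` of `stub_taggedWindowSpanTail` is unconstrained; the reduction is indifferent to its sign.)
[folklore] -/
theorem taggedWindow_lam_nonneg {σ a θ lam c C ℓ τ : ℝ} (ha : 0 < a) (hθ : 0 < θ)
    (hσ : σ ≤ 1 / 2) (hc : 0 < c) (hℓ : 0 < ℓ) {N : ℕ}
    (Φ : HardSphereFlow (Torus.geometry (Fin 3)) (hsDiameter σ N) (N + 1)) (p : Fin (N + 1))
    (h : ∀ M : ℝ, 1 ≤ M →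
      localGibbsLaw σ (fun _ => a) (fun _ => 0) (fun _ => θ) N Φ
        {z | ∃ r : Fin (N + 1), (r = p ∨ r ∈ Φ.backwardCluster p 0 (M * τ) z) ∧
          lam * M * ℓ < Torus.euclidDist (z r).1 (Φ.flow (M * τ) z p).1}
        ≤ ENNReal.ofReal (C * Real.exp (-c * M))) :
    0 ≤ lam := by
  by_contra hlam
  push Not at hlam
  haveI := isProbabilityMeasure_localGibbsLaw (a₀ := fun _ => a) (θ₀ := fun _ => θ)
    (u₀ := fun _ => (0 : V3)) continuous_const continuous_const continuous_const
    (fun _ => ha) (fun _ => hθ) hσ N Φ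
  have ht : Tendsto (fun M : ℝ => C * Real.exp (-c * M)) atTop (𝓝 0) := by
    have h1 : Tendsto (fun M : ℝ => Real.exp (-(c * M))) atTop (𝓝 0) :=
      Real.tendsto_exp_neg_atTop_nhds_zero.comp (tendsto_id.const_mul_atTop hc)
    have h2 := h1.const_mul C
    simp only [mul_zero] at h2
    refine h2.congr fun M => ?_
    rw [neg_mul]
  obtain ⟨M, hM1, hMlt⟩ := ((eventually_ge_atTop (1 : ℝ)).and
    (ht.eventually (gt_mem_nhds zero_lt_one))).exists
  have hM : 0 < M := by linarith
  have hneg : lam * M * ℓ < 0 := mul_neg_of_neg_of_pos (mul_neg_of_neg_of_pos hlam hM) hℓ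
  have key := h M hM1
  rw [taggedWindow_event_eq_univ Φ p hneg, measure_univ] at key
  exact absurd key (not_le.2 (ENNReal.ofReal_lt_one.2 hMlt))

end Summit.AtomisticToContinuum.HydrodynamicLimit.Theorems.GibbsLightConeDegenerate

end
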